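import Literature.Probability.Percolation.Percolation
import HarnessLib

/-!
# A combinatorial Jordan lemma for convex (outerplane) drawings

Solo census (`solo-CriticalPhenomena-informed`), companion of `SoloInformedAnchoredGluing`.
Vertices carry a linear order, read as their cyclic order on a circle, and edges are chords. For a
point `x` and a chord `uv` put `sep x u v := [u < x] xor [v < x]` — the chord separates `x` from the
start of the arc. Two chords with four distinct endpoints *cross* iff `sep x u v ≠ sep y u v`.
The xor of `sep x · ·` over the edges of a walk `o → a` telescopes to `sep x o a` whenever `x` is
off the walk (`sepParity_eq`); if no edge off the walk crosses an edge of the walk, the parity is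
constant along any second walk avoiding the first (`sepParity_eq_of_avoiding`); and for interlaced
endpoint pairs `{o,a}`, `{c,b}` it differs at `c` and `b`. Hence (`exists_mem_support_inter`) in a
convex drawing without crossings every walk `o → a` meets every walk `c → b` — the discrete form
of the Jordan curve theorem that makes the first target on each boundary arc an *anchor*
(`SoloInformedOuterplaneConjecture3`). The six `interlacedᵢ` lemmas list the order patterns of
`o, c, a, b` used by the four-anchor cover (`SoloInformedOuterplaneAnchors`).
-/

namespace Summit.CriticalPhenomena.PercolationContinuityZ3.Theorems

section Outerplane

variable {V : Type*} [LinearOrder V]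

/-- `sep x u v`: exactly one of `u`, `v` lies strictly below `x` (for `x ∉ {u,v}`: `x` is strictly
between `u` and `v`). -/
def sep (x u v : V) : Bool := (decide (u < x)) != (decide (v < x))

/-- A degenerate chord separates nothing. -/
theorem sep_self (x u : V) : sep x u u = false := by
  simp [sep]

/-- Telescoping identity behind the parity count. -/
theorem sep_triangle (x u v w : V) : sep x u w = ((sep x u v) != (sep x v w)) := by
  unfold sep
  generalize decide (u < x) = p
  generalize decide (v < x) = q
  generalize decide (w < x) = r
  cases p <;> cases q <;> cases r <;> rfl

/-- Order pattern `o < c < a < b`: the chord `oa` separates `c` from `b`. -/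
theorem interlaced₁ {o c a b : V} (h₁ : o < c) (h₂ : c < a) (h₃ : a < b) :
    sep c o a ≠ sep b o a := by
  have hob : o < b := h₁.trans (h₂.trans h₃)
  simp [sep, h₁, lt_asymm h₂, hob, h₃]

/-- Order pattern `a < c < o < b`: the chord `oa` separates `c` from `b`. -/
theorem interlaced₂ {o c a b : V} (h₁ : a < c) (h₂ : c < o) (h₃ : o < b) :
    sep c o a ≠ sep b o a := by
  have hab : a < b := h₁.trans (h₂.trans h₃)
  simp [sep, lt_asymm h₂, h₁, h₃, hab]

/-- Order pattern `o < b < a < c`: the chord `oa` separates `c` from `b`. -/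
theorem interlaced₃ {o c a b : V} (h₁ : o < b) (h₂ : b < a) (h₃ : a < c) :
    sep c o a ≠ sep b o a := by
  have hoc : o < c := h₁.trans (h₂.trans h₃)
  simp [sep, hoc, h₃, h₁, lt_asymm h₂]

/-- Order pattern `b < a < c < o`: the chord `oa` separates `c` from `b`. -/
theorem interlaced₄ {o c a b : V} (h₁ : b < a) (h₂ : a < c) (h₃ : c < o) :
    sep c o a ≠ sep b o a := by
  have hbo : b < o := h₁.trans (h₂.trans h₃)
  simp [sep, lt_asymm h₃, h₂, lt_asymm hbo, lt_asymm h₁]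

/-- Order pattern `b < o < c < a`: the chord `oa` separates `c` from `b`. -/
theorem interlaced₅ {o c a b : V} (h₁ : b < o) (h₂ : o < c) (h₃ : c < a) :
    sep c o a ≠ sep b o a := by
  have hba : b < a := h₁.trans (h₂.trans h₃)
  simp [sep, h₂, lt_asymm h₃, lt_asymm h₁, lt_asymm hba]

/-- Order pattern `c < a < b < o`: the chord `oa` separates `c` from `b`. -/
theorem interlaced₆ {o c a b : V} (h₁ : c < a) (h₂ : a < b) (h₃ : b < o) :
    sep c o a ≠ sep b o a := by
  have hco : c < o := h₁.trans (h₂.trans h₃)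
  simp [sep, lt_asymm hco, lt_asymm h₁, lt_asymm h₃, h₂]

variable {G : SimpleGraph V}

/-- XOR of `sep x` over the darts of a walk. -/
def sepParity (x : V) : ∀ {u v : V}, G.Walk u v → Bool
  | _, _, SimpleGraph.Walk.nil => false
  | u, _, SimpleGraph.Walk.cons (v := w) _ p => (sep x u w) != sepParity x p

/-- Telescoping: the XOR of `sep x` along any walk `u → v` equals `sep x u v`. -/
theorem sepParity_eq (x : V) {u v : V} (p : G.Walk u v) : sepParity x p = sep x u v := by
  induction p with
  | nil => simp [sepParity, sep_self]
  | @cons u w v h p ih =>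
    simp only [sepParity, ih]
    exact (sep_triangle x u w v).symm

/-- Two points that see every edge of `p` from the same side have the same parity along `p`. -/
theorem sepParity_congr {y z u v : V} (p : G.Walk u v)
    (h : ∀ a b, G.Adj a b → a ∈ p.support → b ∈ p.support → sep y a b = sep z a b) :
    sepParity y p = sepParity z p := by
  induction p with
  | nil => rfl
  | @cons a b c hadj p ih =>
    simp only [sepParity]
    rw [h a b hadj (by simp) (by simp),
      ih (fun a' b' hab ha hb => h a' b' hab (by simp [ha]) (by simp [hb]))]

/-- Along a walk avoiding `p` whose edges cross no edge of `p`, the parity along `p` is constant. -/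
theorem sepParity_eq_of_avoiding {o a : V} (p : G.Walk o a)
    (hnc : ∀ u v x y, G.Adj u v → G.Adj x y → u ∈ p.support → v ∈ p.support →
      x ∉ p.support → y ∉ p.support → sep x u v = sep y u v) :
    ∀ {c b : V} (q : G.Walk c b), (∀ v ∈ q.support, v ∉ p.support) →
      sepParity c p = sepParity b p := by
  intro c b q
  induction q with
  | nil => intro _; rfl
  | @cons c c' b hadj q ih =>
    intro hav
    have hc : c ∉ p.support := hav c (by simp)
    have hc' : c' ∉ p.support := hav c' (by simp)
    rw [sepParity_congr p (fun u v huv hu hv => hnc u v c c' huv hadj hu hv hc hc')]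
    exact ih (fun v hv => hav v (by simp [hv]))

/-- **Discrete Jordan lemma for convex drawings.** If exactly one of `c, b` lies strictly between
`o` and `a` (the pairs `{o,a}`, `{c,b}` interlace on the circle) and no edge of `p` crosses an edge
both of whose endpoints avoid `p`, then every walk `o → a` meets every walk `c → b` in a vertex. -/
theorem exists_mem_support_inter {o a c b : V} (p : G.Walk o a) (q : G.Walk c b)
    (hint : sep c o a ≠ sep b o a)
    (hnc : ∀ u v x y, G.Adj u v → G.Adj x y → u ∈ p.support → v ∈ p.support →
      x ∉ p.support → y ∉ p.support → sep x u v = sep y u v) :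
    ∃ v, v ∈ p.support ∧ v ∈ q.support := by
  by_contra H
  have H' : ∀ v, v ∈ p.support → v ∉ q.support := fun v hp hq => H ⟨v, hp, hq⟩
  have key := sepParity_eq_of_avoiding p hnc q (fun v hq hp => H' v hp hq)
  rw [sepParity_eq, sepParity_eq] at key
  exact hint key

end Outerplane

end Summit.CriticalPhenomena.PercolationContinuityZ3.Theorems
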